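import Summits.QuantumFields.BalabanUV.T4Continuum.Support.NE7TangentTransportCurvedRightInv
import HarnessLib

/-!
# NE7TangentTransportGaugedTop — THE TANGENT TRANSPORT (TT) OF (APE) BETWEEN A BACKGROUND `W` AND A FIELD WHOSE TOP IS A COARSE GAUGE TRANSFORM OF `W`'s:
# `U_top = (W_top)^c` ⇒ with the CONJUGATED corner lift `λ = lift(Ad_c(F_W Y) − F_U Y)` one has EXACTLY
# `D_U(Y + gaugeDir_U λ)(z,κ) = Q̄_U Y(z,κ) − Ad_{c(z+e_κ)}(Q̄_W Y(z,κ))`, hence the price `c_R·(Λ + 2·θ·Λ_W)`, `θ = ‖c − 1‖_∞`, `Λ_W` the SINGLE-background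
# `ℓ¹` letter of `Q̄_W` (`= K_maj·(L∕L^d)^{k+1} = O(M^{1−d})`) — the top-mismatch obstruction of F70∕F71∕F77 (defect `2·d·ω·C_F`, `C_F = O(1)`) is GONE; letter (L4)
# of the curved (APE) programme, file 18

Cell `pub-balaban`, rung (B)+1 sub-cell t4, lineage `b2b-balaban-t4-ne7-p1` (CRUX PROVER NE7 #1 = OWNER of row NE7), generation 77; memo
`t4/b2b-balaban-t4-ne7-p1-g77/GAUGED-TOP-TT.md`.  File F84 (over F70 `NE7TangentTransportCurved` (`gaugeDir_add_gen`), F71 `NE7TangentTransportCurvedRightInv`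
(the docking with F41's `tangent_correction`), leaf-04's `NE3TangentCovariantTower` (`dirIter_eq_QbarIter_add_gaugeDir`, `dirIter_gaugeDir`, `dirIter_add`), F52's
corner-lift bookkeeping, `NE3PureGaugeFirstVariation.dAction_gaugeDir`, `AveragingDeficitNearIdentity.norm_Ad_sub_le`).
WHY.  Gen 76 located the currency point of the curved (APE): F70's identity `D_U(Y + gaugeDir_U λ) = Q̄_U Y − Q̄_W Y + (Ad_{U_top⁻¹} − Ad_{W_top⁻¹})(F_W Y)` leaves a
defect of size `2·d·ω·C_F·‖Y‖₁` with `ω = ‖U_top − W_top‖_∞` and `C_F = O(1)` (the accumulated frame potential is NOT small in `ℓ¹`), so `ω` would have to be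
`O(small·M^{1−d})`; a B8-type Landau representative `U^u = We^{Z}` (row NE3's E′) of a field over `W`'s datum has `U_top = (W_top)^{u∘M•}`, `ω = O(‖u − 1‖) =
O(M²c_Rb₀)` — hence the brick «REP WITH A FIXED TOP» (F79–F83, a corner-pinned representative), whose last letter (HR_W)ₚ this generation found to FAIL level-uniformly
(flat scalar model, `c_R ≍ M^{d−2}`; memo §1, job j275038).  THIS FILE removes the obstruction instead of the mismatch: when the two tops differ by a COARSE GAUGE
TRANSFORMATION `c` (exactly the situation of ANY representative `U^u` of a field over `W`'s datum, `c = u∘M•`), conjugate the reference frame potential before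
lifting.  By the covariance `gaugeDir_{V^c}(Ad_c f)(z,κ) = Ad_{c(z+e_κ)}(gaugeDir_V f (z,κ))` (§1) and `−Q̄_W Y = gaugeDir_{W_top}(F_W Y)` (tangency at `W`),
`D_U(Y + gaugeDir_U λ) = Q̄_U Y − Ad_{c(·+e_κ)} Q̄_W Y = [Q̄_U Y − Q̄_W Y] + (1 − Ad_{c(·+e_κ)})(Q̄_W Y)`: the residual acts on `Q̄_W Y`, whose `ℓ¹` norm IS
`O(M^{1−d})‖Y‖₁` (`NE7MajorantL1` ∕ `NE7QbarCurvedBaseTower.sum_norm_QbarIter_le_prod`), not on `F_W Y`.  So the (TT) costs `c_R·(Λ + 2θΛ_W)` with `θ = ‖c − 1‖_∞`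
LEVEL-UNIFORMLY SMALL sufficing — for E′, `θ = 4c₀M²c_Rb₀ ≤ 2∕5` in its own regime, and the closing condition is a smallness of the SAME (−2) quantity `M²b₀`.
No pinning, no pointed class, no new elliptic estimate: E′ is enough (F85∕F86 dock it).
WHAT ([folklore]; 0 def, 0 sorry).
§1 `gaugeDir_gaugeAct_Ad` — the covariance of the coarse gauge direction under a gauge transformation of the top; `norm_sub_Ad_le` — `‖X − Ad_u X‖ ≤ 2‖u − 1‖‖X‖`.
§2 **`dirIter_add_gaugeDir_eq_Qbar_sub_Ad_Qbar`** — the identity displayed above, at any `W` of the class with `D_W Y = 0` and `U_top = (W_top)^c`.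
§3 `dirL1_dirIter_add_gaugeDir_conj_le` — its `ℓ¹` size `≤ (Λ + 2·θ·Λ_W)·‖Y‖₁`.
§4 **`tangent_transport_gaugedTop_rightInvW`** — F71's `hTT` SHAPE for the pair `(U, W)` with `U_top = (W_top)^c`: every skew periodic `W`-tangent `Y` has a skew
   periodic `U`-tangent `Y′` with `|dAction U (Y′ − Y)| ≤ a·(curl1C∕(1−θℓ))·(M^d∕M²)·(Λ + 2·θ·Λ_W)·‖Y‖_{ℓ¹}`.
HONEST FRAMING (page 1): lattice kinematics + the exact gauge invariance of the first variation, over tree identities; `Λ`, `Λ_W`, `θ` are HYPOTHESES here (discharged by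
name in F85); (APE) on curved data NOT proved; NOT ONE-STEP, NOT NE7; spine 0∕9; finite T⁴ rung (B)+1 — NOT infinite volume, NOT mass gap, NOT `BetaPertH`, NOT Clay.
Continuum YM on T⁴ ⇐ BetaPertH ∧ nine spine estimates (0/9 proved); BetaPertH ⇐ (D1) ∧ (D4) ∧ CAP+tail; G-an2-4 gates asym, D1 and NE2/3/4.
-/

set_option autoImplicit false

open scoped BigOperators Matrix.Norms.L2Operator
open NormedSpace Finset

namespace Summit.QuantumFields.BalabanUV.T4Continuum.NE7TangentTransportGaugedTop

open Literature.MathematicalPhysics.QuantumFieldTheory.Balaban1983to89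
open B7Prop1Explicit B7Prop2Explicit MatrixLog UnitaryModel
open T4AveragingDeficitWall (IsUnitaryCfg IsSkewDir SmallField Ad dirL1)
open T4AveragingDeficitWallBoundary (IsPeriodicCfg periodBox)
open AveragingDeficitPeriodicCounting (IsPeriodicDir)
open AveragingDeficitMultiLevelPrep (cavgIter LevelSmall tower cavgIter_unitary_small)
open AveragingDeficitMultiLevelBridge (tower_eq)
open AveragingDeficitNearIdentity (norm_Ad_sub_le)
open AveragingDeficitTransport (Ad_mem_skewAdjoint)
open T4AveragingDeficitNonAbelian (Ad_sub Ad_mul)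
open MinimalActionLevels (perWin)
open BlockAveragePushDirGauge (gaugeDir isPeriodicDir_gaugeDir)
open NE3TangentCovariantTower (dirIter QbarIter framePotW dirIter_add dirIter_gaugeDir dirIter_eq_QbarIter_add_gaugeDir)
open NE3CurvedFrameKill (framePotW_skew_periodic pow_succ_mul_eq_tower)
open NE3LandauOrbit (gaugeDir_skew)
open NE3HessForm (dAction)
open NE3PureGaugeFirstVariation (dAction_gaugeDir)
open NE3QbarIterCovLiftPrep (cruxC)
open NE3RightInverseSolveLetters (thetaLoc)
open NE3HatInvCurlLetters (curl1C curl1C_nonneg)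
open NE7TangentTransportGauge (dAction_sub' cornerLift_smul cornerLift_add_period)
open NE7TangentTransport (tangent_correction)
open NE7TangentTransportCurved (gaugeDir_add_gen)

noncomputable section

variable {d : ℕ} {n : Type*} [Fintype n] [DecidableEq n]

/-! ## §1 Covariance of the coarse gauge direction; a norm bookkeeping lemma -/

/-- **COVARIANCE OF THE GAUGE DIRECTION UNDER A GAUGE TRANSFORMATION OF THE BACKGROUND**:
`gaugeDir (V^c) (Ad_c f) (z,κ) = Ad_{c(z+e_κ)} (gaugeDir V f (z,κ))` (`(V^c)(z,κ)⁻¹·c(z) = c(z+e_κ)·V(z,κ)⁻¹`). [folklore] -/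
theorem gaugeDir_gaugeAct_Ad (c : Site d → (Matrix n n ℂ)ˣ) (V : Site d → Fin d → (Matrix n n ℂ)ˣ) (f : Site d → Matrix n n ℂ)
    (z : Site d) (κ : Fin d) :
    gaugeDir (gaugeAct c V) (fun w => Ad (c w) (f w)) z κ = Ad (c (z + e κ)) (gaugeDir V f z κ) := by
  have hgrp : (gaugeAct c V z κ)⁻¹ * c z = c (z + e κ) * (V z κ)⁻¹ := by
    simp only [gaugeAct]; group
  calc gaugeDir (gaugeAct c V) (fun w => Ad (c w) (f w)) z κ
      = Ad ((gaugeAct c V z κ)⁻¹ * c z) (f z) - Ad (c (z + e κ)) (f (z + e κ)) := by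
        simp only [gaugeDir, Ad_mul]
    _ = Ad (c (z + e κ)) (gaugeDir V f z κ) := by
        rw [hgrp, Ad_mul]
        simp only [gaugeDir, Ad_sub]

/-- `‖X − Ad_u X‖ ≤ 2‖u − 1‖‖X‖` for unitary `u`. [folklore] -/
theorem norm_sub_Ad_le [Nonempty n] {u : (Matrix n n ℂ)ˣ} (hu : u ∈ unitaryUnits (Matrix n n ℂ)) (X : Matrix n n ℂ) :
    ‖X - Ad u X‖ ≤ 2 * ‖(u : Matrix n n ℂ) - 1‖ * ‖X‖ := by
  rw [norm_sub_rev]; exact norm_Ad_sub_le hu X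

/-! ## §2 THE IDENTITY: the conjugated corner lift leaves `(1 − Ad_c)` acting on the SMALL straight average `Q̄_W Y` -/

/-- **`D_U(Y + gaugeDir_U λ)(z,κ) = Q̄^{(k+1)}_U Y (z,κ) − Ad_{c(z+e_κ)} (Q̄^{(k+1)}_W Y (z,κ))`** for the corner lift `λ` of `w ↦ Ad_{c(w)}(F_W Y (w)) − F_U Y (w)`,
when `Y` is tangent at the curved reference `W` of the class (`dirIter L (k+1) W Y = 0`) and the top of `U` is the gauge transform of the top of `W` by the
coarse unitary `N`-periodic `c` (`cavgIter L (k+1) U = (cavgIter L (k+1) W)^c`): the structure theorem at `U` and at `W`, the covariance of the average along fine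
gauge directions at `U`, additivity, and §1. [folklore] -/
theorem dirIter_add_gaugeDir_eq_Qbar_sub_Ad_Qbar [Nonempty n] {L N : ℕ} [NeZero N] (hL : 1 ≤ L) (k : ℕ)
    {U W : Site d → Fin d → (Matrix n n ℂ)ˣ} {x : ℝ} (hUu : IsUnitaryCfg U) (hWu : IsUnitaryCfg W)
    (hUP : IsPeriodicCfg U ((tower L N (k + 1) : ℕ) : ℤ)) (hWP : IsPeriodicCfg W ((tower L N (k + 1) : ℕ) : ℤ))
    (hx : 0 ≤ x) (hs : LevelSmall d L k x) (hUx : SmallField U x) (hWx : SmallField W x)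
    {c : Site d → (Matrix n n ℂ)ˣ} (hc : ∀ w, c w ∈ unitaryUnits (Matrix n n ℂ)) (hcP : ∀ (w : Site d) (i : Fin d), c (w + (N : ℤ) • e i) = c w)
    (hTopc : cavgIter L (k + 1) U = gaugeAct c (cavgIter L (k + 1) W))
    {Y : Site d → Fin d → (Matrix n n ℂ)} (hY : IsSkewDir Y) (hYP : IsPeriodicDir Y ((tower L N (k + 1) : ℕ) : ℤ))
    (hYT : dirIter L (k + 1) W Y = 0) (z : Site d) (κ : Fin d) :
    dirIter L (k + 1) U (fun y μ => Y y μ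
        + gaugeDir U (fun xx : Site d => (fun w => Ad (c w) (framePotW L (k + 1) W Y w) - framePotW L (k + 1) U Y w)
            (fun i => xx i / ((L : ℤ) ^ (k + 1)))) y μ) z κ
      = QbarIter L (k + 1) U Y z κ - Ad (c (z + e κ)) (QbarIter L (k + 1) W Y z κ) := by
  have hm : ((L : ℤ) ^ (k + 1)) ≠ 0 := pow_ne_zero _ (by exact_mod_cast (show L ≠ 0 by omega))
  have htow : ((tower L N (k + 1) : ℕ) : ℤ) = (L : ℤ) ^ (k + 1) * (N : ℤ) := (pow_succ_mul_eq_tower L N k).symm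
  -- the two accumulated frame potentials: skew and `N`-periodic; so is the conjugated difference
  set g : Site d → (Matrix n n ℂ) := fun w => Ad (c w) (framePotW L (k + 1) W Y w) - framePotW L (k + 1) U Y w with hg
  obtain ⟨hFUs, hFUP⟩ := framePotW_skew_periodic (M := N) hL k hUu hUP hx hs hUx hY hYP
  obtain ⟨hFWs, hFWP⟩ := framePotW_skew_periodic (M := N) hL k hWu hWP hx hs hWx hY hYP
  have hgs : ∀ w, g w ∈ skewAdjoint (Matrix n n ℂ) := fun w =>
    (skewAdjoint (Matrix n n ℂ)).sub_mem (Ad_mem_skewAdjoint (hc w) (hFWs w)) (hFUs w)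
  have hgP : ∀ (w : Site d) (i : Fin d), g (w + (N : ℤ) • e i) = g w := fun w i => by
    simp only [hg, hFWP w i, hFUP w i, hcP w i]
  -- the corner lift
  set lam : Site d → (Matrix n n ℂ) := fun xx => g (fun i => xx i / ((L : ℤ) ^ (k + 1))) with hlam
  have hlams : ∀ xx, lam xx ∈ skewAdjoint (Matrix n n ℂ) := fun xx => hgs _
  have hlamP : ∀ (y : Site d) (i : Fin d), lam (y + ((tower L N (k + 1) : ℕ) : ℤ) • e i) = lam y := fun y i => by
    rw [htow]; exact cornerLift_add_period g hm hgP y i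
  have hlam_corner : (fun y : Site d => lam (((L : ℤ) ^ (k + 1)) • y)) = g := by
    funext y; exact cornerLift_smul g hm y
  -- the tree identities: additivity and gauge covariance at `U`, the structure theorem at `U` and at `W`
  have hadd := dirIter_add hL k hUu hx hs hUx Y (gaugeDir U lam)
  have hgauge := dirIter_gaugeDir (M := N) hL k hUu hUP hx hs hUx hlams hlamP
  have hstrU := dirIter_eq_QbarIter_add_gaugeDir (M := N) hL k hUu hUP hx hs hUx hY hYP
  have hstrW := dirIter_eq_QbarIter_add_gaugeDir (M := N) hL k hWu hWP hx hs hWx hY hYP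
  -- tangency at `W`: `gaugeDir W_top (F_W Y) (z,κ) = −Q̄_W Y (z,κ)`
  have hW0 : QbarIter L (k + 1) W Y z κ + gaugeDir (cavgIter L (k + 1) W) (framePotW L (k + 1) W Y) z κ = 0 := by
    have h := congr_fun (congr_fun hstrW z) κ
    rw [hYT] at h
    exact h.symm
  have hGW : gaugeDir (cavgIter L (k + 1) W) (framePotW L (k + 1) W Y) z κ = -QbarIter L (k + 1) W Y z κ :=
    eq_neg_of_add_eq_zero_right hW0
  -- the sum of the two coarse gauge directions at `U_top = (W_top)^c` is the conjugated one of `W_top`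
  have hsum : gaugeDir (cavgIter L (k + 1) U) (framePotW L (k + 1) U Y) z κ + gaugeDir (cavgIter L (k + 1) U) g z κ
      = Ad (c (z + e κ)) (gaugeDir (cavgIter L (k + 1) W) (framePotW L (k + 1) W Y) z κ) := by
    have hfun : (fun w => framePotW L (k + 1) U Y w + g w) = fun w => Ad (c w) (framePotW L (k + 1) W Y w) := by
      funext w; simp only [hg]; abel
    rw [← gaugeDir_add_gen, hfun, hTopc, gaugeDir_gaugeAct_Ad]
  have hAdneg : Ad (c (z + e κ)) (gaugeDir (cavgIter L (k + 1) W) (framePotW L (k + 1) W Y) z κ)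
      = -Ad (c (z + e κ)) (QbarIter L (k + 1) W Y z κ) := by
    rw [hGW]; simp only [Ad, mul_neg, neg_mul]
  -- assemble pointwise
  have h1 := congr_fun (congr_fun hadd z) κ
  have h2 := congr_fun (congr_fun hgauge z) κ
  have h3 := congr_fun (congr_fun hstrU z) κ
  rw [h1, h2, h3, hlam_corner, add_assoc, hsum, hAdneg, ← sub_eq_add_neg]

/-! ## §3 The `ℓ¹` size of the identity -/

/-- **`‖D_U(Y + gaugeDir_U λ)‖_{ℓ¹(periodBox N)} ≤ (Λ + 2·θ·Λ_W)·‖Y‖_{ℓ¹(periodBox T)}`** for §2's `λ`, at a `W`-tangent skew `T`-periodic `Y` (`T = tower L N (k+1)`):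
§2's identity, the base-Lipschitz letter `Λ` of the straight towers, and `(1 − Ad_c)` against the SINGLE-background letter `Λ_W` of `Q̄_W`. [folklore] -/
theorem dirL1_dirIter_add_gaugeDir_conj_le [Nonempty n] {L N : ℕ} [NeZero N] (hL : 1 ≤ L) (k : ℕ)
    {U W : Site d → Fin d → (Matrix n n ℂ)ˣ} {x : ℝ} (hUu : IsUnitaryCfg U) (hWu : IsUnitaryCfg W)
    (hUP : IsPeriodicCfg U ((tower L N (k + 1) : ℕ) : ℤ)) (hWP : IsPeriodicCfg W ((tower L N (k + 1) : ℕ) : ℤ))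
    (hx : 0 ≤ x) (hs : LevelSmall d L k x) (hUx : SmallField U x) (hWx : SmallField W x)
    {c : Site d → (Matrix n n ℂ)ˣ} (hc : ∀ w, c w ∈ unitaryUnits (Matrix n n ℂ)) (hcP : ∀ (w : Site d) (i : Fin d), c (w + (N : ℤ) • e i) = c w)
    (hTopc : cavgIter L (k + 1) U = gaugeAct c (cavgIter L (k + 1) W))
    {θ : ℝ} (hθ0 : 0 ≤ θ) (hcθ : ∀ w : Site d, ‖((c w : (Matrix n n ℂ)ˣ) : Matrix n n ℂ) - 1‖ ≤ θ)
    {ΛW : ℝ}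
    (hΛW : ∀ Y : Site d → Fin d → Matrix n n ℂ, IsSkewDir Y → IsPeriodicDir Y ((tower L N (k + 1) : ℕ) : ℤ) → dirIter L (k + 1) W Y = 0 →
      ∑ z ∈ periodBox (d := d) N, ∑ κ : Fin d, ‖QbarIter L (k + 1) W Y z κ‖ ≤ ΛW * dirL1 Y (periodBox (d := d) (tower L N (k + 1))))
    {Λ : ℝ}
    (hΛ : ∀ Y : Site d → Fin d → Matrix n n ℂ, IsSkewDir Y → IsPeriodicDir Y ((tower L N (k + 1) : ℕ) : ℤ) → dirIter L (k + 1) W Y = 0 →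
      ∑ z ∈ periodBox N, ∑ κ : Fin d, ‖QbarIter L (k + 1) U Y z κ - QbarIter L (k + 1) W Y z κ‖
        ≤ Λ * dirL1 Y (periodBox (d := d) (tower L N (k + 1))))
    {Y : Site d → Fin d → Matrix n n ℂ} (hY : IsSkewDir Y) (hYP : IsPeriodicDir Y ((tower L N (k + 1) : ℕ) : ℤ))
    (hYT : dirIter L (k + 1) W Y = 0) :
    dirL1 (dirIter L (k + 1) U (fun y μ => Y y μ
        + gaugeDir U (fun xx : Site d => (fun w => Ad (c w) (framePotW L (k + 1) W Y w) - framePotW L (k + 1) U Y w)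
            (fun i => xx i / ((L : ℤ) ^ (k + 1)))) y μ))
        (periodBox (d := d) N)
      ≤ (Λ + 2 * θ * ΛW) * dirL1 Y (periodBox (d := d) (tower L N (k + 1))) := by
  set ψ := dirIter L (k + 1) U (fun y μ => Y y μ
        + gaugeDir U (fun xx : Site d => (fun w => Ad (c w) (framePotW L (k + 1) W Y w) - framePotW L (k + 1) U Y w)
            (fun i => xx i / ((L : ℤ) ^ (k + 1)))) y μ)
    with hψ
  have hψeq : ∀ (z : Site d) (κ : Fin d), ψ z κ = (QbarIter L (k + 1) U Y z κ - QbarIter L (k + 1) W Y z κ)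
      + (QbarIter L (k + 1) W Y z κ - Ad (c (z + e κ)) (QbarIter L (k + 1) W Y z κ)) := by
    intro z κ
    rw [hψ, dirIter_add_gaugeDir_eq_Qbar_sub_Ad_Qbar hL k hUu hWu hUP hWP hx hs hUx hWx hc hcP hTopc hY hYP hYT z κ]
    abel
  have hdef : ∀ (z : Site d) (κ : Fin d),
      ‖QbarIter L (k + 1) W Y z κ - Ad (c (z + e κ)) (QbarIter L (k + 1) W Y z κ)‖ ≤ 2 * θ * ‖QbarIter L (k + 1) W Y z κ‖ := by
    intro z κ
    refine (norm_sub_Ad_le (hc (z + e κ)) _).trans ?_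
    have h0 : 0 ≤ ‖QbarIter L (k + 1) W Y z κ‖ := norm_nonneg _
    nlinarith [hcθ (z + e κ), norm_nonneg (((c (z + e κ) : (Matrix n n ℂ)ˣ) : Matrix n n ℂ) - 1)]
  have hmain := hΛ Y hY hYP hYT
  have hsingle := hΛW Y hY hYP hYT
  have h2 : 0 ≤ 2 * θ := by positivity
  have hpt : ∀ z ∈ periodBox (d := d) N, ∑ κ : Fin d, ‖ψ z κ‖
      ≤ (∑ κ : Fin d, ‖QbarIter L (k + 1) U Y z κ - QbarIter L (k + 1) W Y z κ‖) + 2 * θ * ∑ κ : Fin d, ‖QbarIter L (k + 1) W Y z κ‖ := by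
    intro z _
    have hκ : ∀ κ : Fin d, ‖ψ z κ‖
        ≤ ‖QbarIter L (k + 1) U Y z κ - QbarIter L (k + 1) W Y z κ‖ + 2 * θ * ‖QbarIter L (k + 1) W Y z κ‖ := by
      intro κ
      rw [hψeq z κ]
      exact (norm_add_le _ _).trans (by linarith [hdef z κ])
    calc ∑ κ : Fin d, ‖ψ z κ‖
        ≤ ∑ κ : Fin d, (‖QbarIter L (k + 1) U Y z κ - QbarIter L (k + 1) W Y z κ‖ + 2 * θ * ‖QbarIter L (k + 1) W Y z κ‖) :=
          Finset.sum_le_sum fun κ _ => hκ κ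
      _ = (∑ κ : Fin d, ‖QbarIter L (k + 1) U Y z κ - QbarIter L (k + 1) W Y z κ‖) + 2 * θ * ∑ κ : Fin d, ‖QbarIter L (k + 1) W Y z κ‖ := by
          rw [Finset.sum_add_distrib, Finset.mul_sum]
  have hsum : dirL1 ψ (periodBox (d := d) N)
      ≤ (∑ z ∈ periodBox N, ∑ κ : Fin d, ‖QbarIter L (k + 1) U Y z κ - QbarIter L (k + 1) W Y z κ‖)
        + 2 * θ * ∑ z ∈ periodBox (d := d) N, ∑ κ : Fin d, ‖QbarIter L (k + 1) W Y z κ‖ := by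
    have h := Finset.sum_le_sum hpt
    rw [Finset.sum_add_distrib, ← Finset.mul_sum] at h
    exact h
  calc dirL1 ψ (periodBox (d := d) N)
      ≤ (∑ z ∈ periodBox N, ∑ κ : Fin d, ‖QbarIter L (k + 1) U Y z κ - QbarIter L (k + 1) W Y z κ‖)
          + 2 * θ * ∑ z ∈ periodBox (d := d) N, ∑ κ : Fin d, ‖QbarIter L (k + 1) W Y z κ‖ := hsum
    _ ≤ Λ * dirL1 Y (periodBox (d := d) (tower L N (k + 1))) + 2 * θ * (ΛW * dirL1 Y (periodBox (d := d) (tower L N (k + 1)))) :=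
        add_le_add hmain (mul_le_mul_of_nonneg_left hsingle h2)
    _ = (Λ + 2 * θ * ΛW) * dirL1 Y (periodBox (d := d) (tower L N (k + 1))) := by ring

/-! ## §4 F66's `hTT` shape for a pair with gauge-equivalent tops, with row NE3's right inverse -/

/-- **THE (TT) LETTER FOR A PAIR WITH GAUGE-EQUIVALENT TOPS, WITH THE EXACT RIGHT INVERSE.**  `L ≥ 2`, `N ≥ 1`, `k` levels, fine period `N·L^{k+1}`; `U`, `W` unitary
periodic in the multi-level class at a common radius `x` with the W5∕W6 regime (`cruxC·M²x < 1`, `thetaLoc·M²x < 1`, `M²x ≤ 1`, `M = L^{k+1}`), `SmallField U a`;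
the top of `U` is the gauge transform of the top of `W` by a coarse unitary `N`-periodic `c` with `‖c − 1‖ ≤ θ`; letters `Λ_W` (single-background straight tower at
`W` in `ℓ¹`) and `Λ` (base-Lipschitz letter of the straight towers).  THEN every skew periodic `Y` with `D_W Y = 0` has a skew periodic `Y′` with `D_U Y′ = 0` and
`|dAction U (Y′ − Y) (perWin d (N·L^{k+1}))| ≤ a·(curl1C∕(1−θℓ))·(M^d∕M²)·(Λ + 2·θ·Λ_W)·‖Y‖_{ℓ¹(periodBox (N·L^{k+1}))}`:
`Y′ = Y₁ − R_U(D_U Y₁)`, `Y₁ = Y + gaugeDir_U λ` (§2's `λ`), by F41's `tangent_correction` at `Y₁`, `dAction_gaugeDir`, and §3. [folklore] -/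
theorem tangent_transport_gaugedTop_rightInvW [Nonempty n] {L : ℕ} (hL : 2 ≤ L) (k : ℕ) {N : ℕ} [NeZero N]
    {U W : Site d → Fin d → (Matrix n n ℂ)ˣ} {x a : ℝ} (hUu : IsUnitaryCfg U) (hWu : IsUnitaryCfg W)
    (hUP : IsPeriodicCfg U ((N * L ^ (k + 1) : ℕ) : ℤ)) (hWP : IsPeriodicCfg W ((N * L ^ (k + 1) : ℕ) : ℤ))
    (hx : 0 ≤ x) (hs : LevelSmall d L k x) (hUx : SmallField U x) (hWx : SmallField W x)
    (hθ : cruxC d L * (((L : ℝ) ^ (k + 1)) ^ 2 * x) < 1) (hθl : thetaLoc d L * (((L : ℝ) ^ (k + 1)) ^ 2 * x) < 1)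
    (hε : ((L : ℝ) ^ (k + 1)) ^ 2 * x ≤ 1) (ha : 0 ≤ a) (hUa : SmallField U a)
    {c : Site d → (Matrix n n ℂ)ˣ} (hc : ∀ w, c w ∈ unitaryUnits (Matrix n n ℂ)) (hcP : ∀ (w : Site d) (i : Fin d), c (w + (N : ℤ) • e i) = c w)
    (hTopc : cavgIter L (k + 1) U = gaugeAct c (cavgIter L (k + 1) W))
    {θ : ℝ} (hθ0 : 0 ≤ θ) (hcθ : ∀ w : Site d, ‖((c w : (Matrix n n ℂ)ˣ) : Matrix n n ℂ) - 1‖ ≤ θ)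
    {ΛW : ℝ}
    (hΛW : ∀ Y : Site d → Fin d → Matrix n n ℂ, IsSkewDir Y → IsPeriodicDir Y ((N * L ^ (k + 1) : ℕ) : ℤ) → dirIter L (k + 1) W Y = 0 →
      ∑ z ∈ periodBox (d := d) N, ∑ κ : Fin d, ‖QbarIter L (k + 1) W Y z κ‖ ≤ ΛW * dirL1 Y (periodBox (d := d) (N * L ^ (k + 1))))
    {Λ : ℝ}
    (hΛ : ∀ Y : Site d → Fin d → Matrix n n ℂ, IsSkewDir Y → IsPeriodicDir Y ((N * L ^ (k + 1) : ℕ) : ℤ) → dirIter L (k + 1) W Y = 0 →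
      ∑ z ∈ periodBox N, ∑ κ : Fin d, ‖QbarIter L (k + 1) U Y z κ - QbarIter L (k + 1) W Y z κ‖
        ≤ Λ * dirL1 Y (periodBox (d := d) (N * L ^ (k + 1)))) :
    ∀ Y : Site d → Fin d → Matrix n n ℂ, IsSkewDir Y → IsPeriodicDir Y ((N * L ^ (k + 1) : ℕ) : ℤ) → dirIter L (k + 1) W Y = 0 →
      ∃ Y' : Site d → Fin d → Matrix n n ℂ, IsSkewDir Y' ∧ IsPeriodicDir Y' ((N * L ^ (k + 1) : ℕ) : ℤ) ∧ dirIter L (k + 1) U Y' = 0 ∧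
        |dAction U (fun y μ => Y' y μ - Y y μ) (perWin d (N * L ^ (k + 1)))|
          ≤ (a * ((curl1C d L / (1 - thetaLoc d L * (((L : ℝ) ^ (k + 1)) ^ 2 * x))) * (((L : ℝ) ^ (k + 1)) ^ d / ((L : ℝ) ^ (k + 1)) ^ 2))
              * (Λ + 2 * θ * ΛW)) * dirL1 Y (periodBox (d := d) (N * L ^ (k + 1))) := by
  intro Y hY hYP hYT
  have hL1 : 1 ≤ L := by omega
  have hm : ((L : ℤ) ^ (k + 1)) ≠ 0 := pow_ne_zero _ (by exact_mod_cast (show L ≠ 0 by omega))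
  -- the period in the tower spelling
  have htow : ((tower L N (k + 1) : ℕ) : ℤ) = ((N * L ^ (k + 1) : ℕ) : ℤ) := by rw [tower_eq]
  have htowN : tower L N (k + 1) = N * L ^ (k + 1) := tower_eq L N (k + 1)
  have hUP' : IsPeriodicCfg U ((tower L N (k + 1) : ℕ) : ℤ) := by rw [htow]; exact hUP
  have hWP' : IsPeriodicCfg W ((tower L N (k + 1) : ℕ) : ℤ) := by rw [htow]; exact hWP
  have hYP' : IsPeriodicDir Y ((tower L N (k + 1) : ℕ) : ℤ) := by rw [htow]; exact hYP
  have htowZ : ((tower L N (k + 1) : ℕ) : ℤ) = (L : ℤ) ^ (k + 1) * (N : ℤ) := (pow_succ_mul_eq_tower L N k).symm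
  -- the conjugated fine gauge generator of §2 and its letters
  set g : Site d → Matrix n n ℂ := fun w => Ad (c w) (framePotW L (k + 1) W Y w) - framePotW L (k + 1) U Y w with hg
  set lam : Site d → Matrix n n ℂ := fun xx => g (fun i => xx i / ((L : ℤ) ^ (k + 1))) with hlam
  obtain ⟨hFUs, hFUP⟩ := framePotW_skew_periodic (M := N) hL1 k hUu hUP' hx hs hUx hY hYP'
  obtain ⟨hFWs, hFWP⟩ := framePotW_skew_periodic (M := N) hL1 k hWu hWP' hx hs hWx hY hYP'
  have hgs : ∀ w, g w ∈ skewAdjoint (Matrix n n ℂ) := fun w =>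
    (skewAdjoint (Matrix n n ℂ)).sub_mem (Ad_mem_skewAdjoint (hc w) (hFWs w)) (hFUs w)
  have hgP : ∀ (w : Site d) (i : Fin d), g (w + (N : ℤ) • e i) = g w := fun w i => by
    simp only [hg, hFWP w i, hFUP w i, hcP w i]
  have hlams : ∀ xx, lam xx ∈ skewAdjoint (Matrix n n ℂ) := fun xx => hgs _
  have hlamP : ∀ (y : Site d) (i : Fin d), lam (y + ((N * L ^ (k + 1) : ℕ) : ℤ) • e i) = lam y := fun y i => by
    rw [← htow, htowZ]; exact cornerLift_add_period g hm hgP y i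
  set G : Site d → Fin d → Matrix n n ℂ := gaugeDir U lam with hG
  have hGs : IsSkewDir G := gaugeDir_skew hUu hlams
  have hGP : IsPeriodicDir G ((N * L ^ (k + 1) : ℕ) : ℤ) := isPeriodicDir_gaugeDir hUP hlamP
  set Y₁ : Site d → Fin d → Matrix n n ℂ := fun y μ => Y y μ + G y μ with hY₁
  have hY₁s : IsSkewDir Y₁ := fun y μ => (skewAdjoint (Matrix n n ℂ)).add_mem (hY y μ) (hGs y μ)
  have hY₁P : IsPeriodicDir Y₁ ((N * L ^ (k + 1) : ℕ) : ℤ) := fun y i μ => by simp only [hY₁, hYP y i μ, hGP y i μ]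
  -- F41's tangent correction at `Y₁`
  obtain ⟨Y', hY's, hY'P, hY'T, hb⟩ := tangent_correction hL k hUu hUP hx hs hUx hθ hθl hε ha hUa hY₁s hY₁P
  refine ⟨Y', hY's, hY'P, hY'T, ?_⟩
  -- `dAction U (Y′ − Y) = dAction U (Y′ − Y₁)` since `dAction U G = 0`
  have hYeq : (fun y μ => Y₁ y μ - G y μ) = Y := by funext y μ; simp only [hY₁, add_sub_cancel_right]
  have hdA : dAction U (fun y μ => Y' y μ - Y y μ) (perWin d (N * L ^ (k + 1)))
      = dAction U (fun y μ => Y' y μ - Y₁ y μ) (perWin d (N * L ^ (k + 1))) := by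
    rw [dAction_sub', dAction_sub']
    conv_lhs => rw [← hYeq, dAction_sub', hG, dAction_gaugeDir, sub_zero]
  rw [hdA]
  refine hb.trans ?_
  -- §3 in the `N·L^{k+1}` spelling
  have hΛW' : ∀ Y : Site d → Fin d → Matrix n n ℂ, IsSkewDir Y → IsPeriodicDir Y ((tower L N (k + 1) : ℕ) : ℤ) → dirIter L (k + 1) W Y = 0 →
      ∑ z ∈ periodBox (d := d) N, ∑ κ : Fin d, ‖QbarIter L (k + 1) W Y z κ‖ ≤ ΛW * dirL1 Y (periodBox (d := d) (tower L N (k + 1))) := by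
    intro Y₂ hY₂ hY₂P hY₂T; rw [htowN]; rw [htow] at hY₂P; exact hΛW Y₂ hY₂ hY₂P hY₂T
  have hΛ' : ∀ Y : Site d → Fin d → Matrix n n ℂ, IsSkewDir Y → IsPeriodicDir Y ((tower L N (k + 1) : ℕ) : ℤ) → dirIter L (k + 1) W Y = 0 →
      ∑ z ∈ periodBox N, ∑ κ : Fin d, ‖QbarIter L (k + 1) U Y z κ - QbarIter L (k + 1) W Y z κ‖
        ≤ Λ * dirL1 Y (periodBox (d := d) (tower L N (k + 1))) := by
    intro Y₂ hY₂ hY₂P hY₂T; rw [htowN]; rw [htow] at hY₂P; exact hΛ Y₂ hY₂ hY₂P hY₂T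
  have h1 := dirL1_dirIter_add_gaugeDir_conj_le hL1 k hUu hWu hUP' hWP' hx hs hUx hWx hc hcP hTopc hθ0 hcθ hΛW' hΛ' hY hYP' hYT
  rw [htowN] at h1
  have hψY₁ : dirIter L (k + 1) U Y₁ = dirIter L (k + 1) U (fun y μ => Y y μ
        + gaugeDir U (fun xx : Site d => (fun w => Ad (c w) (framePotW L (k + 1) W Y w) - framePotW L (k + 1) U Y w)
            (fun i => xx i / ((L : ℤ) ^ (k + 1)))) y μ) := by
    rfl
  have hpos : 0 < 1 - thetaLoc d L * (((L : ℝ) ^ (k + 1)) ^ 2 * x) := by linarith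
  have hcst : 0 ≤ a * ((curl1C d L / (1 - thetaLoc d L * (((L : ℝ) ^ (k + 1)) ^ 2 * x))) * (((L : ℝ) ^ (k + 1)) ^ d / ((L : ℝ) ^ (k + 1)) ^ 2)) := by
    have := curl1C_nonneg d L; positivity
  rw [hψY₁]
  calc a * ((curl1C d L / (1 - thetaLoc d L * (((L : ℝ) ^ (k + 1)) ^ 2 * x))) * (((L : ℝ) ^ (k + 1)) ^ d / ((L : ℝ) ^ (k + 1)) ^ 2)
          * dirL1 (dirIter L (k + 1) U (fun y μ => Y y μ
              + gaugeDir U (fun xx : Site d => (fun w => Ad (c w) (framePotW L (k + 1) W Y w) - framePotW L (k + 1) U Y w)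
                  (fun i => xx i / ((L : ℤ) ^ (k + 1)))) y μ)) (periodBox (d := d) N))
      = (a * ((curl1C d L / (1 - thetaLoc d L * (((L : ℝ) ^ (k + 1)) ^ 2 * x))) * (((L : ℝ) ^ (k + 1)) ^ d / ((L : ℝ) ^ (k + 1)) ^ 2)))
          * dirL1 (dirIter L (k + 1) U (fun y μ => Y y μ
              + gaugeDir U (fun xx : Site d => (fun w => Ad (c w) (framePotW L (k + 1) W Y w) - framePotW L (k + 1) U Y w)
                  (fun i => xx i / ((L : ℤ) ^ (k + 1)))) y μ)) (periodBox (d := d) N) := by ring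
    _ ≤ (a * ((curl1C d L / (1 - thetaLoc d L * (((L : ℝ) ^ (k + 1)) ^ 2 * x))) * (((L : ℝ) ^ (k + 1)) ^ d / ((L : ℝ) ^ (k + 1)) ^ 2)))
          * ((Λ + 2 * θ * ΛW) * dirL1 Y (periodBox (d := d) (N * L ^ (k + 1)))) := mul_le_mul_of_nonneg_left h1 hcst
    _ = _ := by ring

end

end Summit.QuantumFields.BalabanUV.T4Continuum.NE7TangentTransportGaugedTop
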